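import Mathlib.Analysis.Calculus.DifferentialForm.Basic
import Mathlib.Analysis.Normed.Module.Alternating.Curry
import Mathlib.Analysis.Normed.Operator.BoundedLinearMaps
import Mathlib.MeasureTheory.Integral.IntervalIntegral.FundThmCalculus
import Literature.Analysis.FunctionSpaces.SmoothParametricIntegral
import HarnessLib

/-!
# The Poincaré lemma on star-shaped open subsets of a finite-dimensional space

Support for the finite-dimensionality of de Rham cohomology
(`Literature.AlgebraicGeometry.Motives.finite_deRhamCohomology`).

For Mathlib's exterior derivative `extDeriv` of forms `ω : E → E [⋀^Fin (k+1)]→L[ℝ] F` on a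
finite-dimensional real normed space `E` we construct the **radial homotopy operator** centred
at `x₀`,
`coneOperator x₀ ω x = ∫₀¹ t^k • ι_{x - x₀} ω (x₀ + t (x - x₀)) dt`
(a `k`-form), prove that it preserves smoothness (`contDiff_coneOperator`, differentiation under
the integral sign, `Literature.Analysis.FunctionSpaces.contDiff_parametric_intervalIntegral`) and
the **homotopy formula** `d (K ω) + K (d ω) = ω` for smooth `ω` (`extDeriv_coneOperator_add`).
The localisation to forms that are only smooth on a star-shaped open set (the Poincaré lemma
proper, Lee (2013), Thm. 17.14) is in `Literature.Geometry.Kaehler.PoincareLemmaStarConvex`.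

## References

* R. Bott, L. W. Tu, *Differential Forms in Algebraic Topology* (1982), §I.4 (the homotopy
  operator `K` and `dK + Kd = 1 - π^* s^*`), Cor. 4.1.1 (Poincaré lemma).
* J. M. Lee, *Introduction to Smooth Manifolds*, 2nd ed. (2013), Thm. 17.14 (Poincaré lemma for
  star-shaped open subsets of `ℝⁿ`).
* F. W. Warner, *Foundations of Differentiable Manifolds and Lie Groups* (1983), 4.18.
-/

noncomputable section

open scoped Topology ContDiff
open Set Filter MeasureTheory intervalIntegral ContinuousAlternatingMap

namespace Literature.Geometry.Kaehler

variable {E : Type*} [NormedAddCommGroup E] [NormedSpace ℝ E]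
  {F : Type*} [NormedAddCommGroup F] [NormedSpace ℝ F] {k : ℕ}

/-! ### An algebraic identity for `alternatizeUncurryFin` -/

/-- Removing the `(i+1)`-st entry of `vecCons w v` is `vecCons w` of removing the `i`-th entry of
`v`. [folklore] -/
theorem removeNth_succ_vecCons {α : Type*} {n : ℕ} (i : Fin (n + 1)) (w : α) (v : Fin (n + 1) → α) :
    i.succ.removeNth (Matrix.vecCons w v) = Matrix.vecCons w (i.removeNth v) := by
  funext j
  refine Fin.cases ?_ (fun j ↦ ?_) j
  · simp [Fin.removeNth]
  · simp [Fin.removeNth]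

/-- Insertion of a vector in the first slot, `(ω, w) ↦ ι_w ω = ω.curryLeft w`, is a bounded
bilinear map (hence `C^∞`, with the Leibniz derivative). [folklore] -/
theorem isBoundedBilinearMap_curryLeft :
    IsBoundedBilinearMap ℝ (fun p : (E [⋀^Fin (k + 1)]→L[ℝ] F) × E ↦ p.1.curryLeft p.2) where
  add_left := fun f g v ↦ by simp
  smul_left := fun c f v ↦ by simp
  add_right := fun f v w ↦ map_add _ v w
  smul_right := fun c f v ↦ map_smul _ c v
  bound := ⟨1, one_pos, fun f v ↦ by
    rw [one_mul]
    exact (f.curryLeft.le_opNorm v).trans_eq (by rw [norm_curryLeft])⟩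

/-- **The algebraic heart of the homotopy formula.** For a linear family
`f : E →L (E [⋀^Fin (k+1)]→L F)` (think `f = Dω(x)`), a vector `w`, and the linear family
`P h = ι_w (f h)`, one has `Alt P + ι_w (Alt f) = f w`, where `Alt = alternatizeUncurryFin` is
the alternatization underlying `extDeriv` and `ι_w` is insertion in the first slot: the terms of
the two alternating sums cancel in pairs except the one in which `w` itself is extracted.
Bott–Tu (1982), §I.4 (computation in the proof of `dK + Kd = 1`). [cite: BottTu1982Forms, §I.4] -/
theorem alternatizeUncurryFin_add_curryLeft {f : E →L[ℝ] E [⋀^Fin (k + 1)]→L[ℝ] F}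
    {P : E →L[ℝ] E [⋀^Fin k]→L[ℝ] F} {w : E} (hP : ∀ h, P h = (f h).curryLeft w) :
    alternatizeUncurryFin P + (alternatizeUncurryFin f).curryLeft w = f w := by
  ext v
  simp only [ContinuousAlternatingMap.add_apply, curryLeft_apply_apply,
    alternatizeUncurryFin_apply, hP]
  have htail : Fin.tail (Matrix.vecCons w v) = v := funext fun i ↦ by simp [Fin.tail]
  have h2 : ∑ j : Fin (k + 2), (-1 : ℤ) ^ (j : ℕ) •
      f (Matrix.vecCons w v j) (j.removeNth (Matrix.vecCons w v)) =
      f w v - ∑ i : Fin (k + 1), (-1 : ℤ) ^ (i : ℕ) • f (v i) (Matrix.vecCons w (i.removeNth v)) := by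
    rw [Fin.sum_univ_succ]
    simp only [Fin.val_zero, pow_zero, one_smul, Matrix.cons_val_zero, Fin.removeNth_zero, htail,
      Fin.val_succ, Matrix.cons_val_succ, removeNth_succ_vecCons, pow_succ, mul_neg_one, neg_smul,
      Finset.sum_neg_distrib]
    abel
  rw [h2]
  abel

/-- Evaluation at a tuple commutes with the interval integral of an integrable family of
continuous alternating maps (Mathlib's evaluation map `ContinuousAlternatingMap.apply` through
`ContinuousLinearMap.intervalIntegral_comp_comm`). [folklore] -/
theorem intervalIntegral_apply_alternating [CompleteSpace F] {a b : ℝ} {f : ℝ → E [⋀^Fin k]→L[ℝ] F}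
    (hf : IntervalIntegrable f volume a b) (v : Fin k → E) :
    (∫ σ in a..b, f σ) v = ∫ σ in a..b, f σ v := by
  have h := (ContinuousAlternatingMap.apply ℝ E F v).intervalIntegral_comp_comm hf
  simpa using h.symm

/-! ### The radial homotopy operator -/

section Cone

variable (x₀ : E)

/-- The integrand of the radial homotopy operator centred at `x₀`:
`(t, x) ↦ t^k • ι_{x - x₀} ω (x₀ + t (x - x₀))`, a `k`-form for a `(k+1)`-form `ω`.
Bott–Tu (1982), §I.4. [cite: BottTu1982Forms, §I.4] -/
def coneIntegrand (β : E → E [⋀^Fin (k + 1)]→L[ℝ] F) (p : ℝ × E) : E [⋀^Fin k]→L[ℝ] F :=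
  (p.1 ^ k) • (β (x₀ + p.1 • (p.2 - x₀))).curryLeft (p.2 - x₀)

/-- **The radial homotopy operator** (cone construction) centred at `x₀` on forms on a normed
space: `K ω x = ∫₀¹ t^k • ι_{x - x₀} ω (x₀ + t (x - x₀)) dt`, a `k`-form for a `(k+1)`-form `ω`.
It only involves the values of `ω` on the segment `[x₀, x]`. Bott–Tu (1982), §I.4; Lee (2013),
proof of Thm. 17.14 (via Lemma 17.9); Warner (1983), 4.18. [cite: BottTu1982Forms, §I.4] -/
def coneOperator (β : E → E [⋀^Fin (k + 1)]→L[ℝ] F) (x : E) : E [⋀^Fin k]→L[ℝ] F :=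
  ∫ t in (0 : ℝ)..1, coneIntegrand x₀ β (t, x)

/-- `K ω x` depends only on the values of `ω` on the segment from `x₀` to `x`. [folklore] -/
theorem coneOperator_congr {β β' : E → E [⋀^Fin (k + 1)]→L[ℝ] F} {x : E}
    (h : ∀ t ∈ Icc (0 : ℝ) 1, β (x₀ + t • (x - x₀)) = β' (x₀ + t • (x - x₀))) :
    coneOperator x₀ β x = coneOperator x₀ β' x := by
  refine intervalIntegral.integral_congr fun t ht ↦ ?_
  rw [uIcc_of_le zero_le_one] at ht
  simp only [coneIntegrand, h t ht]

/-- The integrand of `K ω` at time `t` is continuous in `t` for continuous `ω`. [folklore] -/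
theorem continuous_coneIntegrand_left {β : E → E [⋀^Fin (k + 1)]→L[ℝ] F} (hβ : Continuous β)
    (x : E) : Continuous fun t : ℝ ↦ coneIntegrand x₀ β (t, x) := by
  simp only [coneIntegrand]
  refine (continuous_id.pow k).smul ?_
  exact isBoundedBilinearMap_curryLeft.continuous.comp
    ((hβ.comp (continuous_const.add (continuous_id.smul continuous_const))).prodMk
      continuous_const)

/-- `K` is linear: additivity. [folklore] -/
theorem coneOperator_add {β β' : E → E [⋀^Fin (k + 1)]→L[ℝ] F} (hβ : Continuous β)
    (hβ' : Continuous β') :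
    coneOperator x₀ (β + β') = coneOperator x₀ β + coneOperator x₀ β' := by
  funext x
  simp only [Pi.add_apply, coneOperator]
  rw [← intervalIntegral.integral_add
    ((continuous_coneIntegrand_left x₀ hβ x).intervalIntegrable _ _)
    ((continuous_coneIntegrand_left x₀ hβ' x).intervalIntegrable _ _)]
  refine intervalIntegral.integral_congr fun t _ ↦ ?_
  simp [coneIntegrand, smul_add]

/-- `K` is linear: homogeneity. [folklore] -/
theorem coneOperator_smul (c : ℝ) (β : E → E [⋀^Fin (k + 1)]→L[ℝ] F) :
    coneOperator x₀ (c • β) = c • coneOperator x₀ β := by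
  funext x
  simp only [coneOperator, Pi.smul_apply]
  rw [← intervalIntegral.integral_smul]
  refine intervalIntegral.integral_congr fun t _ ↦ ?_
  simp [coneIntegrand, smul_comm c]

/-- The integrand of `K ω` is jointly `C^∞` in `(t, x)` for `C^∞` forms `ω`. [folklore] -/
theorem contDiff_coneIntegrand {β : E → E [⋀^Fin (k + 1)]→L[ℝ] F} (hβ : ContDiff ℝ ∞ β) :
    ContDiff ℝ ∞ (coneIntegrand x₀ β) := by
  have hγ : ContDiff ℝ ∞ fun p : ℝ × E ↦ x₀ + p.1 • (p.2 - x₀) :=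
    contDiff_const.add (contDiff_fst.smul (contDiff_snd.sub contDiff_const))
  refine (contDiff_fst.pow k).smul ?_
  exact isBoundedBilinearMap_curryLeft.contDiff.comp
    ((hβ.comp hγ).prodMk (contDiff_snd.sub contDiff_const))

/-- **The partial derivative in `x` of the integrand of `K ω`** at `(t, x)` applied to `h`:
with `γ = x₀ + t (x - x₀)`, it is `t^k • ι_h ω(γ) + t^{k+1} • ι_{x - x₀} (Dω(γ) h)`
(Leibniz rule for the bilinear insertion and the chain rule along `x ↦ γ`). [folklore] -/
theorem fderiv_coneIntegrand_apply {β : E → E [⋀^Fin (k + 1)]→L[ℝ] F} (hβ : ContDiff ℝ ∞ β)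
    (t : ℝ) (x h : E) :
    fderiv ℝ (fun y ↦ coneIntegrand x₀ β (t, y)) x h =
      (t ^ k) • (β (x₀ + t • (x - x₀))).curryLeft h +
        (t ^ (k + 1)) • (fderiv ℝ β (x₀ + t • (x - x₀)) h).curryLeft (x - x₀) := by
  set γ : E := x₀ + t • (x - x₀) with hγ
  have hγ' : HasFDerivAt (fun y : E ↦ x₀ + t • (y - x₀)) (t • ContinuousLinearMap.id ℝ E) x :=
    ((hasFDerivAt_sub_const x₀).const_smul t).const_add x₀
  have hβγ : HasFDerivAt (fun y : E ↦ β (x₀ + t • (y - x₀)))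
      ((fderiv ℝ β γ).comp (t • ContinuousLinearMap.id ℝ E)) x :=
    ((hβ.differentiable (by simp)) γ).hasFDerivAt.comp x hγ'
  have hb := (isBoundedBilinearMap_curryLeft (E := E) (F := F) (k := k)).hasFDerivAt (β γ, x - x₀)
  have hB := hb.comp x (hβγ.prodMk (hasFDerivAt_sub_const x₀))
  have hH : HasFDerivAt (fun y ↦ coneIntegrand x₀ β (t, y)) _ x := hB.const_smul (t ^ k)
  rw [hH.fderiv]
  simp [IsBoundedBilinearMap.deriv_apply, pow_succ, mul_smul]

/-- The integrand of `K ω` at fixed `t` is differentiable in `x`. [folklore] -/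
theorem differentiableAt_coneIntegrand {β : E → E [⋀^Fin (k + 1)]→L[ℝ] F}
    (hβ : ContDiff ℝ ∞ β) (t : ℝ) (x : E) :
    DifferentiableAt ℝ (fun y ↦ coneIntegrand x₀ β (t, y)) x :=
  ((contDiff_coneIntegrand x₀ hβ).comp (contDiff_const.prodMk contDiff_id)).differentiable
    (by simp) x

variable [FiniteDimensional ℝ E]

/-- **The homotopy operator preserves smoothness**: `K ω` is `C^∞` if `ω` is (differentiation
under the integral sign over the compact interval `[0, 1]`,
`Literature.Analysis.FunctionSpaces.contDiff_parametric_intervalIntegral`; `E` finite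
dimensional). [folklore] -/
theorem contDiff_coneOperator {β : E → E [⋀^Fin (k + 1)]→L[ℝ] F} (hβ : ContDiff ℝ ∞ β) :
    ContDiff ℝ ∞ (coneOperator x₀ β) :=
  Literature.Analysis.FunctionSpaces.contDiff_parametric_intervalIntegral
    (contDiff_coneIntegrand x₀ hβ) 0 1

/-- **The homotopy formula** `d (K ω) x + K (dω) x = ω x` for a `C^∞` form `ω` of positive
degree on a finite-dimensional space (any centre `x₀`; `F` complete). Proof: differentiate
under the integral sign, use the algebraic identity `alternatizeUncurryFin_add_curryLeft`
pointwise in `t`, and integrate `d/dt (t^{k+1} ω(x₀ + t(x - x₀)))` by the fundamental theorem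
of calculus. Bott–Tu (1982), §I.4, Prop. 4.1 (`dK + Kd = 1` on forms not involving `dt`);
Lee (2013), Thm. 17.14; Warner (1983), 4.18. [cite: BottTu1982Forms, Prop. 4.1] -/
theorem extDeriv_coneOperator_add [CompleteSpace F] {β : E → E [⋀^Fin (k + 1)]→L[ℝ] F}
    (hβ : ContDiff ℝ ∞ β) (x : E) :
    extDeriv (coneOperator x₀ β) x + coneOperator x₀ (extDeriv β) x = β x := by
  have hinf : (∞ : WithTop ℕ∞) ≠ 0 := by simp
  set w : E := x - x₀ with hw
  have hH : ContDiff ℝ ∞ (coneIntegrand x₀ β) := contDiff_coneIntegrand x₀ hβ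
  -- the partial derivative in `x` of the integrand, at `(σ, x)`
  set D : ℝ → E →L[ℝ] E [⋀^Fin k]→L[ℝ] F :=
    fun σ ↦ fderiv ℝ (fun y ↦ coneIntegrand x₀ β (σ, y)) x with hD
  have hDapply : ∀ σ h, D σ h = (σ ^ k) • (β (x₀ + σ • w)).curryLeft h +
      (σ ^ (k + 1)) • (fderiv ℝ β (x₀ + σ • w) h).curryLeft w := fun σ h ↦
    fderiv_coneIntegrand_apply x₀ hβ σ x h
  have hDH : ∀ σ h, fderiv ℝ (coneIntegrand x₀ β) (σ, x) ((0 : ℝ), h) = D σ h := by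
    intro σ h
    have h1 := (Literature.Analysis.FunctionSpaces.hasFDerivAt_comp_prodMk hH hinf σ x).fderiv
    rw [hD]
    dsimp only
    rw [h1]
    rfl
  -- the derivative of `K β` in the direction `h`, under the integral sign
  have hKd : ∀ h, fderiv ℝ (coneOperator x₀ β) x h = ∫ σ in (0 : ℝ)..1, D σ h := by
    intro h
    have h1 := Literature.Analysis.FunctionSpaces.fderiv_parametric_intervalIntegral_apply hH hinf
      0 1 x h
    simp only [hDH] at h1
    exact h1
  have hDc : ∀ h, Continuous fun σ ↦ D σ h := by
    intro h
    have h1 : Continuous fun σ : ℝ ↦ fderiv ℝ (coneIntegrand x₀ β) (σ, x) ((0 : ℝ), h) :=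
      ((hH.continuous_fderiv hinf).comp (continuous_id.prodMk continuous_const)).clm_apply
        continuous_const
    simp only [hDH] at h1
    exact h1
  -- the second summand and the primitive in `t`
  set dβ : E → E [⋀^Fin (k + 1 + 1)]→L[ℝ] F := extDeriv β with hdβ
  have hdβs : ContDiff ℝ ∞ dβ := by
    rw [hdβ]
    exact (alternatizeUncurryFinCLM ℝ E F).contDiff.comp (hβ.fderiv_right (m := ∞) (by simp))
  set φ : ℝ → E [⋀^Fin (k + 1)]→L[ℝ] F := fun σ ↦ (σ ^ (k + 1)) • β (x₀ + σ • w) with hφ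
  set φ' : ℝ → E [⋀^Fin (k + 1)]→L[ℝ] F := fun σ ↦
    (σ ^ (k + 1)) • fderiv ℝ β (x₀ + σ • w) w + ((k + 1 : ℕ) * σ ^ k) • β (x₀ + σ • w) with hφ'
  have hφderiv : ∀ σ, HasDerivAt φ (φ' σ) σ := by
    intro σ
    have hγ : HasDerivAt (fun σ : ℝ ↦ x₀ + σ • w) w σ := by
      simpa using ((hasDerivAt_id σ).smul_const w).const_add x₀
    have hβγ : HasDerivAt (fun σ : ℝ ↦ β (x₀ + σ • w)) (fderiv ℝ β (x₀ + σ • w) w) σ :=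
      ((hβ.differentiable hinf) _).hasFDerivAt.comp_hasDerivAt σ hγ
    have h : HasDerivAt (fun σ : ℝ ↦ σ ^ (k + 1) • β (x₀ + σ • w))
        (σ ^ (k + 1) • fderiv ℝ β (x₀ + σ • w) w +
          (((k + 1 : ℕ) : ℝ) * σ ^ (k + 1 - 1)) • β (x₀ + σ • w)) σ :=
      (hasDerivAt_pow (k + 1) σ).smul hβγ
    rw [Nat.add_sub_cancel] at h
    exact h
  have hφ'c : Continuous φ' := by
    have h1 : Continuous fun σ : ℝ ↦ x₀ + σ • w :=
      continuous_const.add (continuous_id.smul continuous_const)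
    refine ((continuous_id.pow (k + 1)).smul ?_).add
      ((continuous_const.mul (continuous_id.pow k)).smul (hβ.continuous.comp h1))
    exact ((hβ.continuous_fderiv hinf).comp h1).clm_apply continuous_const
  -- pointwise identity of the integrands
  have hpt : ∀ σ, alternatizeUncurryFin (D σ) + coneIntegrand x₀ dβ (σ, x) = φ' σ := by
    intro σ
    set P : E →L[ℝ] E [⋀^Fin k]→L[ℝ] F := D σ - (σ ^ k) • (β (x₀ + σ • w)).curryLeft with hP
    have hPapply : ∀ h, P h = (((σ ^ (k + 1)) • fderiv ℝ β (x₀ + σ • w)) h).curryLeft w := by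
      intro h
      simp [hP, hDapply]
    have hDeq : D σ = (σ ^ k) • (β (x₀ + σ • w)).curryLeft + P := by
      rw [hP]; abel
    have key := alternatizeUncurryFin_add_curryLeft hPapply
    rw [hDeq, alternatizeUncurryFin_add, alternatizeUncurryFin_smul, alternatizeUncurryFin_curryLeft]
    simp only [coneIntegrand, hdβ, extDeriv, hφ']
    rw [← hw]
    have e1 : σ ^ (k + 1) • (alternatizeUncurryFin (fderiv ℝ β (x₀ + σ • w))).curryLeft w =
        (alternatizeUncurryFin (σ ^ (k + 1) • fderiv ℝ β (x₀ + σ • w))).curryLeft w := by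
      rw [alternatizeUncurryFin_smul, curryLeft_smul]
      rfl
    have e2 : (σ ^ (k + 1) • fderiv ℝ β (x₀ + σ • w)) w = σ ^ (k + 1) • fderiv ℝ β (x₀ + σ • w) w :=
      rfl
    rw [e1, add_assoc, key, e2, ← Nat.cast_smul_eq_nsmul ℝ (k + 1)]
    module
  -- assemble, after evaluating at a tuple of vectors `v`
  ext v
  have hi2 : IntervalIntegrable (fun σ : ℝ ↦ coneIntegrand x₀ dβ (σ, x)) volume 0 1 :=
    (continuous_coneIntegrand_left x₀ hdβs.continuous x).intervalIntegrable 0 1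
  have hi3 : IntervalIntegrable φ' volume 0 1 := hφ'c.intervalIntegrable 0 1
  have hci : ∀ i : Fin (k + 1), Continuous fun σ : ℝ ↦ D σ (v i) (i.removeNth v) := fun i ↦
    (ContinuousAlternatingMap.apply ℝ E F (i.removeNth v)).continuous.comp (hDc (v i))
  have hL1 : extDeriv (coneOperator x₀ β) x v =
      ∫ σ in (0 : ℝ)..1, ∑ i : Fin (k + 1), ((-1 : ℝ) ^ (i : ℕ)) • D σ (v i) (i.removeNth v) := by
    rw [intervalIntegral.integral_finsetSum]
    · simp only [extDeriv, alternatizeUncurryFin_apply, ← Int.cast_smul_eq_zsmul ℝ, Int.cast_pow,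
        Int.cast_neg, Int.cast_one, hKd]
      refine Finset.sum_congr rfl fun i _ ↦ ?_
      rw [intervalIntegral_apply_alternating ((hDc (v i)).intervalIntegrable 0 1),
        intervalIntegral.integral_smul]
    · intro i _
      exact ((hci i).const_smul _).intervalIntegrable 0 1
  have hL1' : ∀ σ, ∑ i : Fin (k + 1), ((-1 : ℝ) ^ (i : ℕ)) • D σ (v i) (i.removeNth v) =
      alternatizeUncurryFin (D σ) v := fun σ ↦ by
    simp only [alternatizeUncurryFin_apply, ← Int.cast_smul_eq_zsmul ℝ, Int.cast_pow,
      Int.cast_neg, Int.cast_one]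
  have hi1 : IntervalIntegrable (fun σ : ℝ ↦ alternatizeUncurryFin (D σ) v) volume 0 1 := by
    have hc : Continuous fun σ : ℝ ↦ ∑ i : Fin (k + 1), ((-1 : ℝ) ^ (i : ℕ)) • D σ (v i) (i.removeNth v) :=
      continuous_finsetSum _ fun i _ ↦ (hci i).const_smul _
    simp only [hL1'] at hc
    exact hc.intervalIntegrable 0 1
  have hi2v : IntervalIntegrable (fun σ : ℝ ↦ coneIntegrand x₀ dβ (σ, x) v) volume 0 1 :=
    ((ContinuousAlternatingMap.apply ℝ E F v).continuous.comp
      (continuous_coneIntegrand_left x₀ hdβs.continuous x)).intervalIntegrable 0 1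
  rw [ContinuousAlternatingMap.add_apply, hL1, coneOperator, intervalIntegral_apply_alternating hi2]
  simp only [hL1']
  rw [← intervalIntegral.integral_add hi1 hi2v]
  have hsum : ∀ σ, alternatizeUncurryFin (D σ) v + coneIntegrand x₀ dβ (σ, x) v = φ' σ v :=
    fun σ ↦ by rw [← ContinuousAlternatingMap.add_apply, hpt]
  simp only [hsum]
  rw [← intervalIntegral_apply_alternating hi3,
    intervalIntegral.integral_eq_sub_of_hasDerivAt (fun σ _ ↦ hφderiv σ) hi3]
  simp [hφ, hw]

end Cone

/-- `K 0 = 0`. [folklore] -/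
@[simp]
theorem coneOperator_zero (x₀ : E) : coneOperator x₀ (0 : E → E [⋀^Fin (k + 1)]→L[ℝ] F) = 0 := by
  funext x
  simp [coneOperator, coneIntegrand]

end Literature.Geometry.Kaehler
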